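import Literature.MathematicalPhysics.QuantumFieldTheory.Balaban1983to89.B7Eq84Concrete

/-!
# B7 Sect. C bookkeeping: the gauge fixing (76)–(77)/(87) of a field that COINCIDES with its background is the
identity gauge transformation (`B7GaugeFixingAtBackground`)

Source: T. Bałaban, *Averaging operations for lattice gauge theories*, Commun. Math. Phys. **98** (1985) 17–51
[cite: Balaban1985Averaging], Sect. C pp. 29–31, formulas (64)–(88) (the block axial gauge relative to a background `U₀`,
the averaging operation (79)–(81) for gauge transformations, the explicit gauge fixing "(77) for `j = k − 1` and (87)").
Page numbers are journal pages.

## What this file is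

`B7Eq84Concrete` constructs, for a background `U₀`, a field `U₁` (the field itself being `U = U₁U₀`, moving frame (55)),
a block size `L ≥ 1` and a number of levels `k`, THE gauge transformation `glev L hL U₀ U₁ k 0` on `ℤ^d` determined by the
block axial gauge conditions (64)/(66)/(67) at the levels `j < k` and the averaging condition (81) at level `k`
(existence `gaugeFixing_exists`, uniqueness `gaugeFixing_unique`; level-`j` readings `glev … k j`, `uLev_glev`).

This file certifies the degenerate case print never spells out but every inductive use of the construction relies on
(B8 = [Balaban1985RegularSpaces] Thm 4, where the gauge fixing `u₁` of [3] = this paper is applied to data that are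
trivial away from the constraint regions): **if the field coincides with the background, `U₁ = 1`, then the gauge
fixing is the identity, `glev L hL U₀ 1 k j = 1` at EVERY level `j`, for EVERY background `U₀`** — because every object
the downward recursion (76)/(87) is built from is then trivial: `Ũ₁^j = (\overline{1·U₀})^j(Ū₀^j)⁻¹ = 1` (69)
(`tildIter_one_right`), the twisted transports `(R̄^j_{0,y}Ũ₁^j)(Γ) = 1` (58), the block averages
`\overline{R_{0,x}U₁^{(j)}} = 1` (85) (`wrec_one_right`), hence `u_k = 1` by (87) and `u_j = R(Ū₀^j(Γ))⁻¹[u_{j+1}·1] = 1` by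
(76), downward in `j` (`glev_one_right`).  Alongside: the identity gauge transformation satisfies the block axial gauge
conditions (67) for `U₁ = 1` at every background (`axialGauge_one_one`; with `B7Eq167Flat.uavg_one_right` = (81) for
`u = 1` this is the input of the uniqueness road `gaugeFixing_unique`, a second proof of `glev … k 0 = 1`).

CONSUMER (why now): the k-level «exactly one solution of (1.117)» theorem of [Balaban1985RegularSpaces] Sect. E
(`B8Eq1117KLevel.eq1117_existsUnique_kLevel`) carries the hypothesis `u₁ = glev L _ U₀ (expCfg B) j 0` on every
constraint tower; its non-vacuity witness `B8Eq1117KLevelWitness.eq1117_kLevel_witness` could inhabit the constraint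
set at ONE level only, its docstring recording that "inhabiting all levels simultaneously with `u₁ = 1` needs
`glev(1, 1) = 1`, a bookkeeping identity of [3]'s (104)–(106) not in the tree as a lemma".  `glev_one_right` (at
`U₀ = 1`, with `B7Prop3GeneralRotated.expCfg_zero`) is that identity.

Everything is kernel-proved algebra over the unit group `𝔸ˣ` of a complex Banach algebra on the infinite lattice `ℤ^d`
(`axialGauge_one_one`, `mgauge_one_one` over any group); no analytic input.  Kind «kernel-checked proof», theorems
only: no `def`, no `… : Prop` fact, no existing module modified.

## Dictionary (print ↦ Lean), as in `B7Eq84Concrete`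

`U₁ = 1` ↦ `(1 : Site d → Fin d → 𝔸ˣ)`; `Ũ₁^j` (69) ↦ `tildIter L U₀ U₁ j`; `(R_{0,y}V′)(Γ)` (58) ↦ `tHol V₀ V′ y Γ`;
`\overline{R_{0,x}U₁^{(j)}}` (85) ↦ `wrec L U₀ U₁ j`; the gauge fixing and its level functions ↦ `glev L hL U₀ U₁ k j`;
(67) for `U′ = U₁^u` ↦ `AxialGauge L U₀ U₁ u k`; the moving-frame action (55) ↦ `mgauge V₀ v V₁`.

## Certified here (kernel)

`mgauge_one_one` (`1^1 = 1` in the moving frame (55)); `tildIter_one_right` ((69) at `U₁ = 1`); `wrec_one_right` ((85) at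
`U₁ = 1`); `glev_one_right`, `glev_one_right_apply` (the gauge fixing of `U₁ = 1` is `1`, every level, every background);
`axialGauge_one_one` ((67) holds for `u = 1`, `U₁ = 1`).

## NOT certified here / related tree facts (cited, not restated)

(81) for `u = 1` is `B7Eq167Flat.uavg_one_right`; `(R_{0,y}1)(Γ) = 1` is `B9Eq3113Proof.tHol_one_right` (re-derived
inline below from the definition, to keep this leaf's imports at `B7Eq84Concrete`); the one-step objects at `V₁ = 1`
(`tild_one_right`, `wframe_one_right`, `dbavgCov_one_right`) are in `B7Prop3GeneralLinear`; `expCfg 0 = 1` is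
`B7Prop3GeneralRotated.expCfg_zero`.  Gauge COVARIANCE of the construction under background gauge transformations
((93) p. 32) is not treated.  Nothing here is a claim about the Yang–Mills mass gap.
-/

noncomputable section

open NormedSpace Finset

namespace Literature.MathematicalPhysics.QuantumFieldTheory.Balaban1983to89.B7GaugeFixingAtBackground

open B7Prop1Explicit B7Prop2Explicit B7AvgGaugeCovariance
open B7Eq92Concrete B7Eq99Concrete B7Eq84Concrete
open B8Ineq130 (fl)
open B8Eq115GaugeFixing (fl_smul fl_block)

-- `Site` alone would resolve to the torus sites of `Setup.lean`; re-export the `ℤ^d` sites of `B7Prop1Explicit`.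
export B7Prop1Explicit (Site)

variable {d : ℕ}

/-! ## §1 Over a group: the identity in the moving frame -/

section GroupAlgebra

variable {G : Type*} [Group G]

/-- In the moving frame (55) at any background `V₀`, the identity gauge transformation fixes the unit field:
`1^{1}_b = 1·1·(R(V_{0,b})1)⁻¹ = 1`. [cite: Balaban1985Averaging, (55) p.27] -/
theorem mgauge_one_one (V₀ : Site d → Fin d → G) :
    mgauge V₀ (1 : Site d → G) (1 : Site d → Fin d → G) = 1 := by
  funext x κ
  simp

end GroupAlgebra

/-! ## §2 The `k`-fold objects and the gauge fixing at `U₁ = 1` -/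

section Units

variable {𝔸 : Type*} [NormedRing 𝔸] [NormedAlgebra ℂ 𝔸] [CompleteSpace 𝔸]

/-- **(69) at `U₁ = 1`**: `Ũ₁^j = (\overline{1·U₀})^j(Ū₀^j)⁻¹ = 1` — if the field is the background, the background-removed
`j`-fold average is the unit configuration, at every level and every background. [cite: Balaban1985Averaging, (69) p.29] -/
@[simp] theorem tildIter_one_right (L : ℕ) (U₀ : Site d → Fin d → 𝔸ˣ) (j : ℕ) :
    tildIter L U₀ (1 : Site d → Fin d → 𝔸ˣ) j = 1 := by
  funext z κ
  rw [tildIter_apply, one_mul, mul_inv_cancel, Pi.one_apply, Pi.one_apply]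

omit [NormedAlgebra ℂ 𝔸] [CompleteSpace 𝔸] in
/-- The twisted transport (58) of the unit configuration along any contour is `1` (at any background `V₀`):
`(R_{0,y}1)(Γ) = (1·V₀)(Γ)·V₀(Γ)⁻¹ = 1`. [cite: Balaban1985Averaging, (58) p.27] -/
private theorem tHol_unit (V₀ : Site d → Fin d → 𝔸ˣ) (y : Site d) (w : List (Letter d)) :
    tHol V₀ (1 : Site d → Fin d → 𝔸ˣ) y w = 1 := by
  rw [tHol, one_mul, mul_inv_cancel]

/-- **(85) at `U₁ = 1`**: the recursively defined block averages `\overline{R_{0,x}U₁^{(j)}}` of the unit field are `1` at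
every level `j` and every background `U₀` (each (85)-integrand is `(R̄^j_{0,y}Ũ₁^j)(Γ_{y,x})·R(Ū₀^j(Γ_{y,x}))1 = 1·1`, and the
site average (78) of the constant `1` is `1`). [cite: Balaban1985Averaging, (85) p.31, (78) p.30] -/
@[simp] theorem wrec_one_right (L : ℕ) (U₀ : Site d → Fin d → 𝔸ˣ) :
    ∀ j : ℕ, wrec L U₀ (1 : Site d → Fin d → 𝔸ˣ) j = 1
  | 0 => rfl
  | j + 1 => by
    funext z
    rw [wrec_succ, wrec_one_right L U₀ j, tildIter_one_right]
    have h : (fun x => tHol (avgIter L U₀ j) (1 : Site d → Fin d → 𝔸ˣ) ((L : ℤ) • z) (treeWord (x - (L : ℤ) • z))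
          * R0fun (avgIter L U₀ j) ((L : ℤ) • z) (1 : Site d → 𝔸ˣ) x)
        = fun _ => (1 : 𝔸ˣ) := by
      funext x
      rw [tHol_unit, R0fun_apply, Pi.one_apply, map_one, one_mul]
    rw [h, savg_const, Pi.one_apply]

/-- The gauge fixing at `U₁ = 1`, all levels at once: for every `n`, every level `j` with `k − j = n` has `u_j = 1`
(induction on `n`: the top case `j ≥ k` is (87) with `wrec_one_right`, the step `j < k` is (76) with the level above,
`Ũ₁^j = 1` and `R(X)1 = 1`). [cite: Balaban1985Averaging, (76) p.29, (87) p.31] -/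
private theorem glev_one_right_aux (L : ℕ) (hL : 1 ≤ L) (U₀ : Site d → Fin d → 𝔸ˣ) (k : ℕ) :
    ∀ n j : ℕ, k - j = n → glev L hL U₀ (1 : Site d → Fin d → 𝔸ˣ) k j = 1
  | 0, j, h => by
    have hjk : ¬ j < k := by omega
    funext x
    rw [glev, dif_neg hjk, wrec_one_right]
    simp only [Pi.one_apply, inv_one]
  | n + 1, j, h => by
    have hjk : j < k := by omega
    have ih := glev_one_right_aux L hL U₀ k n (j + 1) (by omega)
    funext x
    rw [glev_of_lt L hL U₀ _ hjk, ih, tildIter_one_right, tHol_unit]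
    simp only [Pi.one_apply, mul_one, map_one]

/-- **THE GAUGE FIXING OF A FIELD EQUAL TO ITS BACKGROUND IS THE IDENTITY**: for every background `U₀`, every `L ≥ 1`,
every number of levels `k` and EVERY level `j`, the level-`j` function of the gauge transformation determined by the block
axial gauge conditions (67) (`j < k`) and the averaging condition (81) (level `k`) for the field `U₁ = 1` is `u_j = 1` — in
particular the gauge transformation itself, `glev L hL U₀ 1 k 0 = 1`.  (Print determines `u` by "(77) for `j = k − 1` and
(87)", p. 31; with `U₁ = 1` every factor in these formulas is `1`.)  The case `U₀ = 1` is the identity `glev(1, 1) = 1`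
named as missing by `B8Eq1117KLevelWitness`. [cite: Balaban1985Averaging, (76)–(77) p.29–30, (87) p.31] -/
@[simp] theorem glev_one_right (L : ℕ) (hL : 1 ≤ L) (U₀ : Site d → Fin d → 𝔸ˣ) (k j : ℕ) :
    glev L hL U₀ (1 : Site d → Fin d → 𝔸ˣ) k j = 1 :=
  glev_one_right_aux L hL U₀ k (k - j) j rfl

/-- `glev_one_right` pointwise: `(glev L hL U₀ 1 k j) x = 1`. [cite: Balaban1985Averaging, (76)–(77) p.29–30, (87) p.31] -/
theorem glev_one_right_apply (L : ℕ) (hL : 1 ≤ L) (U₀ : Site d → Fin d → 𝔸ˣ) (k j : ℕ) (x : Site d) :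
    glev L hL U₀ (1 : Site d → Fin d → 𝔸ˣ) k j x = 1 := by
  rw [glev_one_right, Pi.one_apply]

/-- The level readings `u_j = uLev L u j` of the gauge fixing `u = glev … k 0` of `U₁ = 1` are all `1` (`uLev_glev` with
`glev_one_right`, for `j ≤ k`; stated for the transformation read through `uLev`, the currency of (84)/(87)).
[cite: Balaban1985Averaging, (77) p.30, (87) p.31] -/
theorem uLev_glev_one_right (L : ℕ) (hL : 1 ≤ L) (U₀ : Site d → Fin d → 𝔸ˣ) (k : ℕ) {j : ℕ} (hj : j ≤ k) :
    uLev L (glev L hL U₀ (1 : Site d → Fin d → 𝔸ˣ) k 0) j = 1 := by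
  rw [uLev_glev L hL U₀ _ k j hj, glev_one_right]

/-- **(67) for the identity transformation at `U₁ = 1`**: at every background `U₀` and every `k`, `U′ = 1^{1} = 1`
satisfies the block axial gauge conditions (64)/(66)/(67) at all levels `j < k` (each condition reads
`(R̄^j_{0,y}Ũ′^j)(Γ_{y,x}) = (R̄^j_{0,y}1)(Γ_{y,x}) = 1`).  Together with (81) for `u = 1` (`B7Eq167Flat.uavg_one_right`) and
`B7Eq84Concrete.gaugeFixing_unique` this is the uniqueness road to `glev L hL U₀ 1 k 0 = 1`.
[cite: Balaban1985Averaging, (67) p.29, (81) p.30] -/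
theorem axialGauge_one_one (L : ℕ) (U₀ : Site d → Fin d → 𝔸ˣ) (k : ℕ) :
    B7Eq84Concrete.AxialGauge L U₀ (1 : Site d → Fin d → 𝔸ˣ) (1 : Site d → 𝔸ˣ) k := by
  intro j _ z r
  rw [mgauge_one_one, tildIter_one_right, tHol_unit]

/-- **The gauge-fixed field of `U₁ = 1` is `1`**: `U′ = U₁^{u}` with `u = glev … k 0` is the unit configuration again (so the
field `U′U₀` IS the background `U₀`: fixing the gauge of the background relative to itself changes nothing).
[cite: Balaban1985Averaging, (55) p.27, (87)–(88) p.31] -/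
theorem mgauge_glev_one_right (L : ℕ) (hL : 1 ≤ L) (U₀ : Site d → Fin d → 𝔸ˣ) (k : ℕ) :
    mgauge U₀ (glev L hL U₀ (1 : Site d → Fin d → 𝔸ˣ) k 0) (1 : Site d → Fin d → 𝔸ˣ) = 1 := by
  rw [glev_one_right, mgauge_one_one]

end Units

#print axioms glev_one_right
#print axioms axialGauge_one_one

end Literature.MathematicalPhysics.QuantumFieldTheory.Balaban1983to89.B7GaugeFixingAtBackground

end
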